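import Literature.AnabelianGeometry.SemiGraphs.TemperedAnabelian
import Mathlib.NumberTheory.Padics.Complex
import Mathlib.RingTheory.RootsOfUnity.AlgebraicallyClosed
import Mathlib.RingTheory.RootsOfUnity.EnoughRootsOfUnity
import Mathlib.Topology.Algebra.Constructions
import HarnessLib

/-!
# The cyclotome `μ_N = ℤ/Nℤ(1)` of `ℚ̄_p` as a finite discrete cyclic `G_{ℚ_p}`-module
# ([EtTh] §2, p. 44: "`Δ_{μ_N} := (ℤ/Nℤ)(1)`; `Π_{μ_N,K} := Δ_{μ_N} ⋊ G_K`")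

Mochizuki, *The étale theta function …*, Publ. RIMS **45** (2009), §2, PRIMS PDF p. 44 (printed 270)
[cite: MochizukiEtTh2009, Def 2.10 p.44]. Layer L2 of the abc-iut cell, wave-2 unit W2-L2-04, seat
abc-iut-L2-t8; support file for `DoubleUnderline.lean` / `ThetaEnvOfSetting.lean`.

Over the tree's `p`-adic vocabulary (`PadicAlgCl p = ℚ̄_p`, Mathlib; `SemiGraphs.GQp p = Gal(ℚ̄_p/ℚ_p)`,
`SemiGraphs/TemperedAnabelian.lean`) the cyclotome of [EtTh] p. 44 is a REAL object: `MuN p N` := the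
`N`-th roots of unity of `ℚ̄_p` (Mathlib `rootsOfUnity`), a cyclic group of order `N` (Mathlib:
`ℚ̄_p` is algebraically closed of characteristic `0`, `HasEnoughRootsOfUnity`), finite and discrete,
with the Galois action `galMuN p N : G_{ℚ_p} →* Aut(μ_N)` by restriction of field automorphisms
(Mathlib `MulEquiv.restrictRootsOfUnity`). Nothing of [EtTh] is asserted; these are definitions and
Mathlib facts packaged in the shape the interface `ThetaEnvData` (`MonoThetaEnv.lean`) consumes.
-/

noncomputable section

namespace Literature.AnabelianGeometry.EtaleTheta

open Literature.AnabelianGeometry.SemiGraphs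

variable (p : ℕ) [Fact p.Prime]

/-- **`μ_N = Δ_{μ_N} := (ℤ/Nℤ)(1)`** (p. 44): the group of `N`-th roots of unity of `ℚ̄_p`, written
multiplicatively. [cite: MochizukiEtTh2009, Def 2.10 p.44] -/
abbrev MuN (N : ℕ+) : Type := ↥(rootsOfUnity N (PadicAlgCl p))

variable (N : ℕ+)

/-- `μ_N` is finite (as a `Fintype`, for `ThetaEnvData.finMu`). [cite: MochizukiEtTh2009, Def 2.10 p.44] -/
instance MuN.instFintype : Fintype (MuN p N) := Fintype.ofFinite _

/-- `μ_N ≅ ℤ/Nℤ` has exactly `N` elements (`ℚ̄_p` is algebraically closed of characteristic zero).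
[cite: MochizukiEtTh2009, Def 2.10 p.44] -/
theorem card_MuN : Fintype.card (MuN p N) = N := by
  rw [← Nat.card_eq_fintype_card]
  exact HasEnoughRootsOfUnity.natCard_rootsOfUnity (PadicAlgCl p) N

/-- `μ_N` is cyclic. [cite: MochizukiEtTh2009, Def 2.10 p.44] -/
theorem isCyclic_MuN : IsCyclic (MuN p N) := inferInstance

/-- `μ_N ⊆ ℚ̄_p^×` is discrete (a finite subset of a Hausdorff group).
[cite: MochizukiEtTh2009, Def 2.10 p.44] -/
instance MuN.instDiscreteTopology : DiscreteTopology (MuN p N) := inferInstance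

/-- **The Galois action on `μ_N`**: `G_{ℚ_p} = Gal(ℚ̄_p/ℚ_p) → Aut(μ_N)`, `σ ↦ (ζ ↦ σ ζ)` — the action
through which "`Π_{μ_N,K} := Δ_{μ_N} ⋊ G_K`" is formed (p. 44). [cite: MochizukiEtTh2009, Def 2.10 p.44] -/
def galMuN : GQp p →* MulAut (MuN p N) where
  toFun σ := (σ : PadicAlgCl p ≃ₐ[ℚ_[p]] PadicAlgCl p).toRingEquiv.toMulEquiv.restrictRootsOfUnity N
  map_one' := by
    ext ζ
    rfl
  map_mul' σ τ := by
    ext ζ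
    rfl

/-- The Galois action on `μ_N` in coordinates: `σ` acts on a root of unity by applying `σ`.
[cite: MochizukiEtTh2009, Def 2.10 p.44] -/
@[simp] theorem galMuN_apply_coe (σ : GQp p) (ζ : MuN p N) :
    (((galMuN p N σ ζ : MuN p N) : (PadicAlgCl p)ˣ) : PadicAlgCl p) = σ ((ζ : (PadicAlgCl p)ˣ) : _) :=
  rfl

end Literature.AnabelianGeometry.EtaleTheta

end
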